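import Mathlib
import Mathlib.Analysis.Complex.Basic
import Mathlib.Algebra.CharP.Defs
import Literature.Computability.AlgebraicComplexity.ArithCircuit
import Literature.Computability.AlgebraicComplexity.ValiantClasses
import Literature.Computability.AlgebraicComplexity.StandardFamilies
import HarnessLib.Audit
import HarnessLib

/-!
# VPNeVNPComplex — CONJECTURE (obligation of PneNP/PneNP)

Unproven conjecture migrated by the gate from `Literature/Computability/AlgebraicComplexity/ValiantConjecture.lean` (`Literature.Computability.AlgebraicComplexity.VPNeVNPComplex`): unproven conjectures are obligations of our
theories, not literature facts (human ruling 2026-08-15). Provenance: BurgisserClausenShokrollahi1997. Routes use it as a crux item or via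
`--conditional-bridge --conditional-on VPNeVNPComplex`; a proof goes in the sibling `Theorems/VPNeVNPComplexHolds.lean` as `theorem VPNeVNPComplex_holds : VPNeVNPComplex` so this file stays a conjecture LEAF that Literature/ may import.
-/

namespace Summit.PneNP.PneNP

open Literature Literature.Computability Literature.Computability.AlgebraicComplexity
open Literature.Computability.AlgebraicComplexity
universe u

/-- OPEN CONJECTURE — **pnp.S03**, **Valiant's hypothesis over `ℂ`**, the flag statement
`VP_ℂ ≠ VNP_ℂ` (Valiant 1979), posed in Bürgisser–Clausen–Shokrollahi 1997, §21.1, "(21.19) Valiant's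
Hypothesis. `VP ≠ VNP` over any field." (p. 549) and listed open there, §21.7, "Problem 21.4. Is
Valiant's hypothesis true?"; von zur Gathen 1987, §4: "Valiant's hypothesis. Over any field `F`, there
exist p-definable families of polynomials that are not p-computable" (`= VP ≠ VNP` since `VP ⊆ VNP`);
Bürgisser 2000, Def. 2.4–2.5 with Thm. 2.10; Bürgisser 2024 (arXiv:2406.06217), §2.6: "Valiant's
conjecture. We have `VP^F ≠ VNP^F` over any field `F`. This fundamental conjecture is widely open",
Rem. 2.26(2): its truth depends only on the characteristic, so `F = ℂ` is the characteristic-`0` case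
[status: open]. The `Prop` `VP ℂ ≠ VNP ℂ`: the class of (bundled) p-computable p-families over `ℂ`
differs from the class of p-definable families over `ℂ` (`VP`, `VNP` of `ValiantClasses.lean`). This is
definitionally the summit statement `ValiantsHypothesis` (`= Literature.PNP.ValiantHypothesis ℂ`); an
open conjecture recorded as a `def … : Prop` (CONVENTIONS §4), never asserted: no
`VPNeVNPComplex_holds` is to be expected, users take it as a hypothesis `(h : VPNeVNPComplex)`.
Name and statement unchanged (verdict clean-up 2026-08-15, see the module docstring "Registry").
[cite: BurgisserClausenShokrollahi1997, (21.19) p. 549 and Problem 21.4] -/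
@[conjecture] def VPNeVNPComplex : Prop :=
  VP ℂ ≠ VNP ℂ

end Summit.PneNP.PneNP
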